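import Literature.Algebra.Homology.OrderedCechContraction
import Literature.Algebra.Homology.OrderedCechMap
import Literature.Algebra.Homology.FiniteFreeResolution
import HarnessLib

/-!
# A sub-family onto which the identity retracts by twisted cone contractions is quasi-isomorphic

[topic Algebra/Homology]

Let `G ≤ F : Finset ι → Submodule A 𝕂` be monotone families in one ambient `A`-module `𝕂`
(`Literature/Algebra/Homology/OrderedCech`: `F s = Γ(W_s, 𝓕)`, `G s = Γ(W_s, 𝓖)` for subsheaves
`𝓖 ⊆ 𝓕 ⊆ 𝒦` of a constant sheaf on the finite intersections `W_s` of a cover) and `Č•(G) → Č•(F)`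
the morphism of ordered Čech complexes induced by the inclusion
(`Literature/Algebra/Homology/OrderedCechMap`, `OrderedCech.complexMap LinearMap.id`).
`Literature/Algebra/Homology/OrderedCechContraction` proves, for an endomorphism `r` of `𝕂` with
`r (F (s ∪ i)) ⊆ F s` and the cone contraction `h = OrderedCech.coneHom r i` twisted by `r`, the
homotopy identity `d h + h d = r` in positive degrees, and deduces the partition-of-unity
acyclicity criterion (`Σ_k a_k r_k = id` forces `Č•(F)` to be exact). This file proves the
RELATIVE version of that criterion:

**Theorem** (`OrderedCech.quasiIso_complexMap_of_coneRetraction`). *Suppose there are finitely many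
`A`-linear endomorphisms `r_k` of `𝕂` and vertices `i_k` with `r_k (F (s ∪ i_k)) ⊆ F s` and
`r_k (G (s ∪ i_k)) ⊆ G s` for ALL `s` (including `s = ∅`), and an endomorphism `π` with
`π (F s) ⊆ G s` for `s ≠ ∅`, such that `Σ_k r_k x + π x = x` on every `F s`, `s ≠ ∅`, and
`F ∅ ≤ G ∅`. Then `Č•(G) → Č•(F)` is a quasi-isomorphism.*

Indeed `K = Σ_k h_k` satisfies `d K + K d = id - π` in positive degrees and `K d = id - π - const`
in degree `0` (`const` = a constant `0`-cochain with value in `F ∅`), all operators preserve the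
sub-complex `Č•(G)`, and `π` pushes `Č•(F)` into `Č•(G)`; so every cocycle `z` of `F` is
`π z + d (K z)` with `π z` a cocycle of `G`, and a cocycle `x` of `G` with `x = d c` in `Č•(F)` is
`d (π c + K x)` in `Č•(G)` — the elementwise criterion `quasiIso_of_surj_inj`
(`Literature/Algebra/Homology/FiniteFreeResolution`). This is the homological-algebra skeleton of
J. Frenkel's Laurent-series proof of `H^q(𝐏_r(ℂ)^h, 𝒪^h(n)) = H^q(𝐏_r, 𝒪(n))` (J.-P. Serre, GAGA,
n° 13, Lemmes 4–5 and footnote (4): "On peut aussi calculer directement `H^q(X^h, 𝒪^h)` en utilisant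
le recouvrement ouvert de `X` défini au n° 16, ainsi que des développements en séries de Laurent
(J. Frenkel, non publié)"), where `F` is the family of holomorphic sections, `G` the Laurent
polynomial sections, `r_k` the "regular part in the variable `x_k`" composed with the principal
parts in the earlier variables, and `π` the total principal part.

Contents (everything is proved; no named facts; the only definitions are the three cochain-level
plumbing maps `Cochain.const`, `Cochain.push`, `retractHom`):

* `OrderedCech.sign_pair_mul`, `OrderedCech.coe_coneHom_d_zero` — the degree-`0` companion of
  `d_coneHom_add_coneHom_d`: `(h (d c))_j = r (c_j) - r (c_i)` for a `0`-cochain `c`;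
* `OrderedCech.Cochain.const` (constant `0`-cochains), `OrderedCech.Cochain.push` (a cochain of `F`
  pushed into `G` by `π`) and their bookkeeping;
* `OrderedCech.retractHom` (`K = Σ_k h_k`), `OrderedCech.d_retractHom_add_retractHom_d`,
  `OrderedCech.retractHom_d_zero` — the identities for `K`;
* `OrderedCech.exists_cocycle_add_d_of_coneRetraction` (surjectivity on cohomology, elementwise),
  `OrderedCech.exists_map_eq_of_coneRetraction_zero` (degree `0`),
  `OrderedCech.exists_d_eq_of_coneRetraction` (injectivity, elementwise),
  **`OrderedCech.quasiIso_complexMap_of_coneRetraction`**.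

## References

* J.-P. Serre, *Géométrie algébrique et géométrie analytique*, Ann. Inst. Fourier 6 (1956), n° 13,
  Lemmes 4–5 and footnote (4) (pdf p. 21–22 of the held copy `paper:doi-10-5802-aif-59`).
  [SerreGAGA1956]
* The Stacks Project, Tags 0G6T, 01X9 (cone contractions of the ordered Čech complex).
  [StacksProject]
-/

universe u w

open CategoryTheory Finset

namespace Literature.Algebra.Homology

namespace OrderedCech

variable {ι : Type} [LinearOrder ι]
variable {A : Type u} [CommRing A]
variable {𝕂 : Type u} [AddCommGroup 𝕂] [Module A 𝕂] {F G : Finset ι → Submodule A 𝕂}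

/-! ### The cone contraction on `1`-cochains of the form `d c` -/

/-- For a two-element set `{i, j}`: `ε({i,j}, i) · ε({i,j}, j) = -1`. [folklore] -/
private theorem sign_pair_mul {i j : ι} (hij : i ≠ j) :
    sign A ({i, j} : Finset ι) i * sign A ({i, j} : Finset ι) j = -1 := by
  have key := sign_mul_sign_erase_add (A := A) (s := ({i, j} : Finset ι))
    (Finset.mem_insert_self i {j}) (Finset.mem_insert_of_mem (Finset.mem_singleton_self j)) hij
  have h1 : ({i, j} : Finset ι).erase i = {j} := by
    rw [Finset.erase_insert]
    simp [hij]
  have h2 : ({i, j} : Finset ι).erase j = {i} := by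
    rw [Finset.pair_comm, Finset.erase_insert]
    simp [Ne.symm hij]
  have hs : ∀ a : ι, sign A ({a} : Finset ι) a = 1 := fun a => by
    unfold sign
    rw [show ({a} : Finset ι).filter (· < a) = ∅ from ?_, Finset.card_empty, pow_zero]
    ext b
    simp only [Finset.mem_filter, Finset.mem_singleton, Finset.notMem_empty, iff_false, not_and]
    rintro rfl
    exact lt_irrefl _
  rw [h1, h2, hs, hs, mul_one, mul_one] at key
  have hsq := sign_mul_sign_self (A := A) ({i, j} : Finset ι) i
  have hj : sign A ({i, j} : Finset ι) j = -sign A ({i, j} : Finset ι) i :=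
    eq_neg_of_add_eq_zero_right key
  rw [hj, mul_neg, hsq]

variable (hF : Monotone F)

section ConeZero

variable (r : 𝕂 →ₗ[A] 𝕂) (i : ι)
  (hr : ∀ s : Finset ι, s.Nonempty → ∀ x ∈ F (insert i s), r x ∈ F s)

/-- **The cone contraction on `d` of a `0`-cochain**: `(h (d c))_j = r (c_j) - r (c_i)` for every
vertex `j` (for `j = i` both sides vanish). The degree-`0` companion of
`d_coneHom_add_coneHom_d` (the contraction of the EXTENDED ordered Čech complex, Stacks Project,
Tag 0G6T). [cite: StacksProject, Tag 0G6T] -/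
theorem coe_coneHom_d_zero (c : Cochain F 0) (j : ι) :
    ((coneHom r i hr 0 (d F hF 0 c)) (vertex j) : 𝕂) =
      r (c (vertex j) : 𝕂) - r (c (vertex i) : 𝕂) := by
  by_cases hji : j = i
  · rw [hji, coe_coneHom_apply_of_mem r i hr _ (vertex i) (by simp), sub_self]
  · have hij : i ≠ j := Ne.symm hji
    have hnot : i ∉ (vertex j).1 := by simp [hij]
    have e1 : c.ext0 ({j} : Finset ι) = (c (vertex j) : 𝕂) := Cochain.ext0_val c (vertex j)
    have e2 : c.ext0 ({i} : Finset ι) = (c (vertex i) : 𝕂) := Cochain.ext0_val c (vertex i)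
    have h1 : ({i, j} : Finset ι).erase i = {j} := by
      rw [Finset.erase_insert]
      simp [hij]
    have h2 : ({i, j} : Finset ι).erase j = {i} := by
      rw [Finset.pair_comm, Finset.erase_insert]
      simp [hji]
    rw [coe_coneHom_apply_of_not_mem r i hr _ (vertex j) hnot]
    change sign A ({i, j} : Finset ι) i • r ((d F hF 0 c).ext0 {i, j}) = _
    rw [ext0_d F hF 0 c _ (by simp [Finset.card_pair hij]), Finset.sum_pair hij, h1, h2, e1, e2,
      map_add, map_smul, map_smul, smul_add, smul_smul, smul_smul, sign_mul_sign_self, one_smul,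
      sign_pair_mul hij, neg_one_smul, sub_eq_add_neg]

end ConeZero

/-! ### Constant `0`-cochains and cochains pushed into a sub-family -/

/-- The constant `0`-cochain with value `v` at every vertex (`v` must lie in every `F {j}`, e.g.
`v ∈ F ∅`). [folklore] -/
def Cochain.const (v : 𝕂) (hv : ∀ j : ι, v ∈ F {j}) : Cochain F 0 := fun σ =>
  ⟨v, by
    obtain ⟨j, hj⟩ := exists_eq_vertex σ
    rw [hj, vertex_val]
    exact hv j⟩

/-- The value of a constant cochain. [folklore] -/
@[simp] private theorem Cochain.coe_const_apply (v : 𝕂) (hv : ∀ j : ι, v ∈ F {j})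
    (σ : Simplex ι 0) :
    ((Cochain.const v hv : Cochain F 0) σ : 𝕂) = v := rfl

/-- Constant `0`-cochains are cocycles. [folklore] -/
private theorem d_const (v : 𝕂) (hv : ∀ j : ι, v ∈ F {j}) : d F hF 0 (Cochain.const v hv) = 0 :=
  (d_zero_eq_zero_iff F hF _).2 fun _ _ => rfl

variable (hG : Monotone G) (hGF : ∀ s, G s ≤ F s)

omit [LinearOrder ι] in
include hGF in
/-- The inclusion `G s ≤ F s` in the form consumed by `OrderedCech.complexMap LinearMap.id` (a map
of presheaves induces a map of Čech complexes, Stacks Project, Tag 01ED).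
[cite: StacksProject, Tag 01ED] -/
theorem id_mapsTo_of_le : ∀ s, ∀ x ∈ G s, (LinearMap.id : 𝕂 →ₗ[A] 𝕂) x ∈ F s :=
  fun s _ hx => hGF s hx

/-- A cochain of `F` pushed into the sub-family `G` along an endomorphism `π` with `π (F s) ⊆ G s`
(`s ≠ ∅`). [folklore] -/
def Cochain.push (π : 𝕂 →ₗ[A] 𝕂) (hπ : ∀ s : Finset ι, s.Nonempty → ∀ x ∈ F s, π x ∈ G s)
    (n : ℤ) : Cochain F n →ₗ[A] Cochain G n where
  toFun c σ := ⟨π (c σ : 𝕂), hπ σ.1 σ.2.1 _ (c σ).2⟩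
  map_add' c c' := by
    funext σ
    apply Subtype.ext
    change π ((c σ : 𝕂) + (c' σ : 𝕂)) = π (c σ : 𝕂) + π (c' σ : 𝕂)
    rw [map_add]
  map_smul' a c := by
    funext σ
    apply Subtype.ext
    change π (a • (c σ : 𝕂)) = a • π (c σ : 𝕂)
    rw [map_smul]

/-- The value of a pushed cochain. [folklore] -/
@[simp] private theorem Cochain.coe_push_apply (π : 𝕂 →ₗ[A] 𝕂)
    (hπ : ∀ s : Finset ι, s.Nonempty → ∀ x ∈ F s, π x ∈ G s) {n : ℤ} (c : Cochain F n)
    (σ : Simplex ι n) : ((Cochain.push π hπ n c) σ : 𝕂) = π (c σ : 𝕂) := rfl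

/-- Including a pushed cochain back into `F` is applying `π` pointwise. [folklore] -/
private theorem map_push (π : 𝕂 →ₗ[A] 𝕂)
    (hπ : ∀ s : Finset ι, s.Nonempty → ∀ x ∈ F s, π x ∈ G s)
    (hπF : ∀ s : Finset ι, s.Nonempty → ∀ x ∈ F s, π x ∈ F s) {n : ℤ} (c : Cochain F n) :
    Cochain.map LinearMap.id (id_mapsTo_of_le hGF) n (Cochain.push π hπ n c) =
      Cochain.mapEnd π hπF n c :=
  funext fun _ => Subtype.ext rfl

/-- Including a constant cochain of `G` into `F` gives the constant cochain of `F`. [folklore] -/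
private theorem map_const (v : 𝕂) (hvG : ∀ j : ι, v ∈ G {j}) (hvF : ∀ j : ι, v ∈ F {j}) :
    Cochain.map LinearMap.id (id_mapsTo_of_le hGF) 0 (Cochain.const v hvG) = Cochain.const v hvF :=
  funext fun _ => Subtype.ext rfl

/-! ### The retraction homotopy `K = Σ_k h_k` -/

section Retract

variable {κ : Type w} [Fintype κ] (r : κ → (𝕂 →ₗ[A] 𝕂)) (i : κ → ι) (π : 𝕂 →ₗ[A] 𝕂)
  (hrF : ∀ k (s : Finset ι), ∀ x ∈ F (insert (i k) s), r k x ∈ F s)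
  (hπF : ∀ s : Finset ι, s.Nonempty → ∀ x ∈ F s, π x ∈ F s)
  (hsum : ∀ s : Finset ι, s.Nonempty → ∀ x ∈ F s, ∑ k, r k x + π x = x)

omit [Fintype κ] in
include hrF in
/-- The hypothesis of `coneHom` extracted from `hrF`. [folklore] -/
private theorem coneHyp (k : κ) :
    ∀ s : Finset ι, s.Nonempty → ∀ x ∈ F (insert (i k) s), r k x ∈ F s :=
  fun s _ => hrF k s

/-- **The retraction homotopy** `K = Σ_k h_k : Čⁿ⁺¹(F) → Čⁿ(F)`, the sum of the cone contractions
with vertices `i_k` twisted by `r_k`. [folklore] -/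
def retractHom (n : ℤ) : Cochain F (n + 1) →ₗ[A] Cochain F n :=
  ∑ k, coneHom (r k) (i k) (coneHyp r i hrF k) n

/-- The value of `retractHom`. [folklore] -/
private theorem coe_retractHom_apply {n : ℤ} (c : Cochain F (n + 1)) (τ : Simplex ι n) :
    ((retractHom r i hrF n c) τ : 𝕂) =
      ∑ k, ((coneHom (r k) (i k) (coneHyp r i hrF k) n c) τ : 𝕂) := by
  rw [retractHom, LinearMap.sum_apply, Cochain.coe_sum_apply]

include hsum in
/-- **`d K + K d = id - π` in positive degrees** (sum of the homotopy identities
`d h_k + h_k d = r_k` and `Σ_k r_k = id - π`; Stacks Project, Tag 01X9, proof, with `Σ_k r_k`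
short of the identity by `π`).
[cite: StacksProject, Tag 01X9 (proof)] [cite: StacksProject, Tag 0G6T] -/
theorem d_retractHom_add_retractHom_d {n : ℤ} (hn : 0 ≤ n) (c : Cochain F (n + 1)) :
    d F hF n (retractHom r i hrF n c) + retractHom r i hrF (n + 1) (d F hF (n + 1) c) =
      c - Cochain.mapEnd π hπF (n + 1) c := by
  have hk : ∀ k, d F hF n (coneHom (r k) (i k) (coneHyp r i hrF k) n c) +
      coneHom (r k) (i k) (coneHyp r i hrF k) (n + 1) (d F hF (n + 1) c) =
        Cochain.mapEnd (r k) (mapsTo_of_insert hF (r k) (i k) (coneHyp r i hrF k)) (n + 1) c :=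
    fun k => d_coneHom_add_coneHom_d hF (r k) (i k) (coneHyp r i hrF k) hn c
  rw [retractHom, retractHom, LinearMap.sum_apply, LinearMap.sum_apply, map_sum,
    ← Finset.sum_add_distrib]
  simp_rw [hk]
  funext σ
  apply Subtype.ext
  rw [Cochain.coe_sum_apply]
  change ∑ k, r k (c σ : 𝕂) = (c σ : 𝕂) - π (c σ : 𝕂)
  rw [eq_sub_iff_add_eq]
  exact hsum σ.1 σ.2.1 _ (c σ).2

include hrF in
/-- The value `w(c) = Σ_k r_k (c_{i_k}) ∈ F ∅` entering the degree-`0` identity. [folklore] -/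
private theorem sum_apply_vertex_mem (c : Cochain F 0) :
    ∑ k, r k (c (vertex (i k)) : 𝕂) ∈ F ∅ := by
  refine Submodule.sum_mem _ fun k _ => hrF k ∅ _ ?_
  rw [Finset.insert_empty, ← vertex_val (i k)]
  exact (c (vertex (i k))).2

include hsum in
/-- **`K d = id - π - const` in degree `0`**: for a `0`-cochain `c`,
`(K (d c))_j = c_j - π c_j - w(c)` with `w(c) = Σ_k r_k (c_{i_k})` (which lies in `F ∅`, hence in
every `F {j}`; the extended-complex form of the contraction, Stacks Project, Tag 0G6T).
[cite: StacksProject, Tag 0G6T] -/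
theorem retractHom_d_zero (c : Cochain F 0)
    (hw : ∀ j : ι, (∑ k, r k (c (vertex (i k)) : 𝕂)) ∈ F {j}) :
    retractHom r i hrF 0 (d F hF 0 c) =
      c - Cochain.mapEnd π hπF 0 c - Cochain.const (∑ k, r k (c (vertex (i k)) : 𝕂)) hw := by
  funext σ
  apply Subtype.ext
  obtain ⟨j, rfl⟩ := exists_eq_vertex σ
  rw [coe_retractHom_apply]
  simp_rw [coe_coneHom_d_zero hF]
  rw [Finset.sum_sub_distrib]
  change ∑ k, r k (c (vertex j) : 𝕂) - ∑ k, r k (c (vertex (i k)) : 𝕂) =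
    (c (vertex j) : 𝕂) - π (c (vertex j) : 𝕂) - ∑ k, r k (c (vertex (i k)) : 𝕂)
  congr 1
  rw [eq_sub_iff_add_eq]
  exact hsum {j} (Finset.singleton_nonempty j) _ (c (vertex j)).2

end Retract

/-! ### The relative criterion -/

section Criterion

variable {κ : Type w} [Fintype κ] (r : κ → (𝕂 →ₗ[A] 𝕂)) (i : κ → ι) (π : 𝕂 →ₗ[A] 𝕂)
  (hrF : ∀ k (s : Finset ι), ∀ x ∈ F (insert (i k) s), r k x ∈ F s)
  (hrG : ∀ k (s : Finset ι), ∀ x ∈ G (insert (i k) s), r k x ∈ G s)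
  (hπ : ∀ s : Finset ι, s.Nonempty → ∀ x ∈ F s, π x ∈ G s)
  (hsum : ∀ s : Finset ι, s.Nonempty → ∀ x ∈ F s, ∑ k, r k x + π x = x)
  (h0 : F ∅ ≤ G ∅)

omit [LinearOrder ι] in
include hGF hπ in
/-- `π` preserves the `F s`, `s ≠ ∅` (through `G s ≤ F s`). [folklore] -/
private theorem mapsTo_F_of_push : ∀ s : Finset ι, s.Nonempty → ∀ x ∈ F s, π x ∈ F s :=
  fun s hs x hx => hGF s (hπ s hs x hx)

/-- The retraction homotopy of `G` included into `F` is the retraction homotopy of `F` of the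
included cochain (both are `Σ_k ε · r_k (c_{τ ∪ i_k})`). [folklore] -/
private theorem map_retractHom {n : ℤ} (c : Cochain G (n + 1)) :
    Cochain.map LinearMap.id (id_mapsTo_of_le hGF) n (retractHom r i hrG n c) =
      retractHom r i hrF n (Cochain.map LinearMap.id (id_mapsTo_of_le hGF) (n + 1) c) := by
  funext τ
  apply Subtype.ext
  rw [Cochain.coe_map_apply, coe_retractHom_apply, coe_retractHom_apply, LinearMap.id_apply]
  refine Finset.sum_congr rfl fun k _ => ?_
  rw [coe_coneHom_apply, coe_coneHom_apply, Cochain.ext0_map, LinearMap.id_apply]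

include hrF hπ hsum in
/-- **Surjectivity on cohomology, elementwise**: every cocycle `z ∈ Čⁿ⁺¹(F)`, `n ≥ 0`, is
`π z + d (K z)` with `π z ∈ Čⁿ⁺¹(G)` a cocycle (Frenkel's argument, Serre GAGA n° 13 footnote (4),
run on the contraction of Stacks Project, Tag 0G6T).
[cite: SerreGAGA1956, n° 13 Lemmes 4–5 and footnote (4)] [cite: StacksProject, Tag 0G6T] -/
theorem exists_cocycle_add_d_of_coneRetraction {n : ℤ} (hn : 0 ≤ n) (z : Cochain F (n + 1))
    (hz : d F hF (n + 1) z = 0) :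
    ∃ g : Cochain G (n + 1), d G hG (n + 1) g = 0 ∧
      ∃ b : Cochain F n, Cochain.map LinearMap.id (id_mapsTo_of_le hGF) (n + 1) g =
        z - d F hF n b := by
  have hπF := mapsTo_F_of_push hGF π hπ
  have key := d_retractHom_add_retractHom_d hF r i π hrF hπF hsum hn z
  rw [hz, map_zero, add_zero] at key
  have hπz : Cochain.mapEnd π hπF (n + 1) z = z - d F hF n (retractHom r i hrF n z) := by
    rw [key, sub_sub_cancel]
  refine ⟨Cochain.push π hπ (n + 1) z, ?_, retractHom r i hrF n z, ?_⟩
  · -- `d (π z) = 0`: include into `F`, where `π z = z - d (K z)`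
    apply Cochain.map_injective LinearMap.id (id_mapsTo_of_le hGF) (fun _ _ _ h => h)
    rw [← d_map LinearMap.id (id_mapsTo_of_le hGF) hG hF, map_push hGF π hπ hπF, map_zero, hπz,
      map_sub, hz, d_d, sub_zero]
  · rw [map_push hGF π hπ hπF, hπz]

include hrF hπ hsum h0 in
/-- **Degree `0`**: every `0`-cocycle of `F` lies in `Č⁰(G)` (it is `π c` plus a constant cochain
with value in `F ∅ ≤ G ∅`). [cite: SerreGAGA1956, n° 13 Lemmes 4–5 and footnote (4)]
[cite: StacksProject, Tag 0G6T] -/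
theorem exists_map_eq_of_coneRetraction_zero (c : Cochain F 0) (hc : d F hF 0 c = 0) :
    ∃ g : Cochain G 0, d G hG 0 g = 0 ∧
      Cochain.map LinearMap.id (id_mapsTo_of_le hGF) 0 g = c := by
  have hπF := mapsTo_F_of_push hGF π hπ
  have hwF : (∑ k, r k (c (vertex (i k)) : 𝕂)) ∈ F ∅ := sum_apply_vertex_mem r i hrF c
  have hwG : (∑ k, r k (c (vertex (i k)) : 𝕂)) ∈ G ∅ := h0 hwF
  have key := retractHom_d_zero hF r i π hrF hπF hsum c (fun _ => hF (Finset.empty_subset _) hwF)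
  rw [hc, map_zero] at key
  have hconst := map_const hGF (∑ k, r k (c (vertex (i k)) : 𝕂))
    (fun _ => hG (Finset.empty_subset _) hwG) (fun _ => hF (Finset.empty_subset _) hwF)
  refine ⟨Cochain.push π hπ 0 c + Cochain.const (∑ k, r k (c (vertex (i k)) : 𝕂))
    (fun _ => hG (Finset.empty_subset _) hwG), ?_, ?_⟩
  · apply Cochain.map_injective LinearMap.id (id_mapsTo_of_le hGF) (fun _ _ _ h => h)
    rw [← d_map LinearMap.id (id_mapsTo_of_le hGF) hG hF, map_zero, map_add,
      map_push hGF π hπ hπF, hconst, map_add, d_mapEnd F hF, hc, map_zero, d_const hF, add_zero]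
  · rw [map_add, map_push hGF π hπ hπF, hconst]
    have key' := key.symm
    rw [sub_sub, sub_eq_zero] at key'
    exact key'.symm

include hrF hrG hπ hsum in
/-- **Injectivity on cohomology, elementwise**: a cocycle `x ∈ Čⁿ⁺¹(G)` which is a coboundary
`d c` in `Č•(F)` is a coboundary in `Č•(G)`, namely `d (π c + K x)` (for `n ≥ 1` by the homotopy
identity at `c`, for `n = 0` by its degree-`0` companion, the constant cochain being a cocycle).
[cite: SerreGAGA1956, n° 13 Lemmes 4–5 and footnote (4)] [cite: StacksProject, Tag 0G6T] -/
theorem exists_d_eq_of_coneRetraction {n : ℤ} (hn : 0 ≤ n) (x : Cochain G (n + 1))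
    (c : Cochain F n)
    (hc : Cochain.map LinearMap.id (id_mapsTo_of_le hGF) (n + 1) x = d F hF n c) :
    ∃ c' : Cochain G n, d G hG n c' = x := by
  have hπF := mapsTo_F_of_push hGF π hπ
  refine ⟨Cochain.push π hπ n c + retractHom r i hrG n x, ?_⟩
  apply Cochain.map_injective LinearMap.id (id_mapsTo_of_le hGF) (fun _ _ _ h => h)
  rw [← d_map LinearMap.id (id_mapsTo_of_le hGF) hG hF, map_add, map_push hGF π hπ hπF,
    map_retractHom hGF r i hrF hrG, hc, map_add, d_mapEnd F hF]
  -- `d (π c) + d (K (d c)) = d c`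
  rcases eq_or_lt_of_le hn with h | hn'
  · -- degree `0`: `K (d c) = c - π c - const`
    subst h
    rw [retractHom_d_zero hF r i π hrF hπF hsum c
        (fun _ => hF (Finset.empty_subset _) (sum_apply_vertex_mem r i hrF c)),
      map_sub, map_sub, d_const hF, sub_zero, d_mapEnd F hF, add_sub_cancel]
  · obtain ⟨m, rfl⟩ : ∃ m : ℤ, n = m + 1 := ⟨n - 1, by omega⟩
    have key := d_retractHom_add_retractHom_d hF r i π hrF hπF hsum (show 0 ≤ m by omega) c
    -- apply `d` to the identity: `d K d c = d c - d π c` (as `d d = 0`)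
    have key' := congrArg (d F hF (m + 1)) key
    rw [map_add, d_d, zero_add, map_sub, d_mapEnd F hF] at key'
    rw [key', add_sub_cancel]

include hrF hrG hπ hsum h0 in
/-- **The relative cone-contraction criterion.** Let `G ≤ F` be monotone families in one ambient
module, `r_k` (finitely many) and `π` endomorphisms with `r_k (F (s ∪ i_k)) ⊆ F s`,
`r_k (G (s ∪ i_k)) ⊆ G s` for all `s`, `π (F s) ⊆ G s` and `Σ_k r_k + π = id` on `F s` for `s ≠ ∅`,
and `F ∅ ≤ G ∅`. Then the inclusion `Č•(G) → Č•(F)` of ordered Čech complexes is a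
quasi-isomorphism (the homotopy `K = Σ_k h_k` of twisted cone contractions retracts `Č•(F)` onto
`Č•(G)` up to `π`; Serre, GAGA n° 13 footnote (4), the shape of Frenkel's argument).
[cite: SerreGAGA1956, n° 13 Lemmes 4–5 and footnote (4)] [cite: StacksProject, Tag 0G6T] -/
theorem quasiIso_complexMap_of_coneRetraction :
    QuasiIso (complexMap LinearMap.id (id_mapsTo_of_le hGF) hG hF) := by
  apply quasiIso_of_surj_inj
  · -- surjectivity on `Hʲ`
    intro j z hz
    rcases lt_trichotomy j 0 with hj | rfl | hj
    · haveI := isEmpty_simplex_of_neg (ι := ι) hj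
      have hz0 : z = 0 := Subsingleton.elim (α := Cochain F j) z 0
      refine ⟨0, by rw [map_zero], 0, ?_⟩
      rw [map_zero, map_zero, add_zero, hz0]
    · rw [complex_d] at hz
      change d F hF 0 z = 0 at hz
      obtain ⟨g, hg, hgz⟩ :=
        exists_map_eq_of_coneRetraction_zero hF hG hGF r i π hrF hπ hsum h0 z hz
      refine ⟨g, ?_, 0, ?_⟩
      · rw [complex_d]
        exact hg
      · rw [map_zero, add_zero, complexMap_f]
        exact hgz
    · obtain ⟨n, rfl⟩ : ∃ n : ℤ, j = n + 1 := ⟨j - 1, by omega⟩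
      rw [complex_d] at hz
      change d F hF (n + 1) z = 0 at hz
      obtain ⟨g, hg, b, hb⟩ :=
        exists_cocycle_add_d_of_coneRetraction hF hG hGF r i π hrF hπ hsum (by omega) z hz
      have hd : ((complex F hF).d (n + 1 - 1) (n + 1)).hom
          (((complex F hF).XIsoOfEq (show n + 1 - 1 = n by omega)).inv.hom (-b)) =
            d F hF n (-b) := by
        rw [← LinearMap.comp_apply, ← ModuleCat.hom_comp, HomologicalComplex.XIsoOfEq_inv_comp_d,
          complex_d]
        rfl
      refine ⟨g, ?_, ((complex F hF).XIsoOfEq (show n + 1 - 1 = n by omega)).inv.hom (-b), ?_⟩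
      · rw [complex_d]
        exact hg
      · rw [sub_eq_add_neg] at hb
        rw [hd, map_neg, complexMap_f]
        exact hb
  · -- injectivity on `Hʲ⁺¹`
    rintro j x hx ⟨c, hc⟩
    rcases lt_or_ge j 0 with hj | hj
    · -- `j < 0`: either no simplices in degree `j + 1`, or `j + 1 = 0` where `c = 0`
      rcases lt_or_eq_of_le (show j + 1 ≤ 0 by omega) with hj' | hj'
      · haveI := isEmpty_simplex_of_neg (ι := ι) hj'
        exact ⟨0, by rw [map_zero]; exact (Subsingleton.elim (α := Cochain G (j + 1)) x 0).symm⟩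
      · haveI := isEmpty_simplex_of_neg (ι := ι) (show j < 0 by omega)
        have hc0 : c = 0 := Subsingleton.elim (α := Cochain F j) c 0
        rw [hc0, map_zero, complexMap_f] at hc
        change Cochain.map LinearMap.id (id_mapsTo_of_le hGF) (j + 1) x = 0 at hc
        have hx0 : x = 0 :=
          Cochain.map_injective LinearMap.id (id_mapsTo_of_le hGF) (fun _ _ _ h => h)
            (hc.trans (map_zero _).symm)
        exact ⟨0, by rw [hx0]; exact map_zero _⟩
    · rw [complexMap_f, complex_d] at hc
      change Cochain.map LinearMap.id (id_mapsTo_of_le hGF) (j + 1) x = d F hF j c at hc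
      obtain ⟨c', hc'⟩ := exists_d_eq_of_coneRetraction hF hG hGF r i π hrF hrG hπ hsum hj x c hc
      refine ⟨c', ?_⟩
      rw [complex_d]
      exact hc'

end Criterion

end OrderedCech

end Literature.Algebra.Homology
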